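import Summits.FinalStateConjecture.FinalStateConjecture.Theorems.EIHFluxBalanceInertialRecessionStubRechartTransportLaw
import Summits.FinalStateConjecture.FinalStateConjecture.Theorems.EIHFluxBalanceInertialRecessionStubSlavingHelpers

/-!
# Route EIHFluxBalance — `InertialRecession` (E′), line `SketchCleanExcision`, skeleton r13,
# stub `stub_higherOrderSlaving` (EF): the painted radius sees only the `4`-velocity and the axis

Helper file for the crux `stmt-FinalStateConjecture-17403`
(`Summit.FinalStateConjecture.FinalStateConjecture.Theses.EIHFluxBalance.InertialRecession`, E′),
registered stub `stub_higherOrderSlaving` (orders two and three of frozen-vacuum slaving).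

The Kerr–Schild radius of a rest position `y` depends only on `‖ỹ‖` and `y³`; for two Lorentz
frames with the same `e₀` column (and, if `a ≠ 0`, the same `e₃` column) the rest positions of a lab
point have the same `η`-square, the same time component `y⁰ = −η(x − c, u)` and (if needed) the same
`y³ = η(x − c, Λe₃)`, hence the same painted radius (`higherOrder_radius_poincareInv_eq_of_columns`);
and moving the centre along the `4`-velocity does not change it
(`higherOrder_radius_poincareInv_centre_add_smul`). This lets the higher-order slaving steps use the
REPRESENTATIVE frames of `…StubHigherOrderHoleFrame` inside the radius conditions of the crux, which
are written with the painted frames.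

No definitions, no named facts, no `sorry`.
-/

set_option linter.dupNamespace false
set_option maxSynthPendingDepth 6

noncomputable section

namespace Summit.FinalStateConjecture.FinalStateConjecture.Theorems.SublinearIsFree.Slaving

open Set Function Literature.Geometry.Lorentzian
  Summit.FinalStateConjecture.FinalStateConjecture.Theorems
  Summit.FinalStateConjecture.FinalStateConjecture.Theorems.SublinearIsFree.Rechart

/-- The Kerr–Schild radius depends only on the spatial norm and the third coordinate. [folklore] -/
theorem higherOrder_radius_eq_of_spatialNorm_eq_of_apply_three_eq (a : ℝ) {y y' : E4}
    (hn : E4.spatialNorm y = E4.spatialNorm y') (h3 : y 3 = y' 3) :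
    Kerr.radius a y = Kerr.radius a y' := by
  unfold Kerr.radius; rw [hn, h3]

/-- Components of a rest position through `η`: `y⁰ = −η(y, e₀) = −η(w, Λe₀)` and
`y³ = η(y, e₃) = η(w, Λe₃)` for `y = Λ⁻¹ w`. [folklore] -/
theorem higherOrder_restComponents (Λ : lorentzGroup) (w : E4) :
    ((Λ : E4 ≃L[ℝ] E4).symm w) 0 = -Minkowski.bilin w ((Λ : E4 ≃L[ℝ] E4) (E4.basisVector 0)) ∧
    ((Λ : E4 ≃L[ℝ] E4).symm w) 3 = Minkowski.bilin w ((Λ : E4 ≃L[ℝ] E4) (E4.basisVector 3)) ∧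
    Minkowski.bilin ((Λ : E4 ≃L[ℝ] E4).symm w) ((Λ : E4 ≃L[ℝ] E4).symm w) = Minkowski.bilin w w := by
  set y : E4 := (Λ : E4 ≃L[ℝ] E4).symm w with hy
  have hw : (Λ : E4 ≃L[ℝ] E4) y = w := (Λ : E4 ≃L[ℝ] E4).apply_symm_apply w
  refine ⟨?_, ?_, ?_⟩
  · have h := Λ.2 y (E4.basisVector 0)
    rw [hw, minkowski_basisVector_zero_right] at h
    linarith
  · have h := Λ.2 y (E4.basisVector 3)
    rw [hw, minkowski_basisVector_three_right] at h
    exact h.symm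
  · have h := Λ.2 y y
    rw [hw] at h
    exact h.symm

/-- **Two Lorentz frames with the same `4`-velocity (and, for `a ≠ 0`, the same axis) paint the same
Kerr–Schild radius.** [folklore] -/
theorem higherOrder_radius_poincareInv_eq_of_columns {Λ₁ Λ₂ : lorentzGroup} {a : ℝ}
    (h0 : (Λ₁ : E4 ≃L[ℝ] E4) (E4.basisVector 0) = (Λ₂ : E4 ≃L[ℝ] E4) (E4.basisVector 0))
    (h3 : a = 0 ∨ (Λ₁ : E4 ≃L[ℝ] E4) (E4.basisVector 3) = (Λ₂ : E4 ≃L[ℝ] E4) (E4.basisVector 3))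
    (c x : E4) : Kerr.radius a (poincareInv Λ₁ c x) = Kerr.radius a (poincareInv Λ₂ c x) := by
  obtain ⟨a0, a3, aq⟩ := higherOrder_restComponents Λ₁ (x - c)
  obtain ⟨b0, b3, bq⟩ := higherOrder_restComponents Λ₂ (x - c)
  have hsn : E4.spatialNorm (poincareInv Λ₁ c x) = E4.spatialNorm (poincareInv Λ₂ c x) := by
    have h1 := minkowski_bilin_self ((Λ₁ : E4 ≃L[ℝ] E4).symm (x - c))
    have h2 := minkowski_bilin_self ((Λ₂ : E4 ≃L[ℝ] E4).symm (x - c))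
    have hsq : E4.spatialNorm ((Λ₁ : E4 ≃L[ℝ] E4).symm (x - c)) ^ 2 =
        E4.spatialNorm ((Λ₂ : E4 ≃L[ℝ] E4).symm (x - c)) ^ 2 := by
      have : ((Λ₁ : E4 ≃L[ℝ] E4).symm (x - c)) 0 ^ 2 = ((Λ₂ : E4 ≃L[ℝ] E4).symm (x - c)) 0 ^ 2 := by
        rw [a0, b0, h0]
      linarith [aq.trans bq.symm]
    exact (pow_left_inj₀ (E4.spatialNorm_nonneg _) (E4.spatialNorm_nonneg _) two_ne_zero).1 hsq
  rcases h3 with rfl | h3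
  · rw [Kerr.radius_zero_left, Kerr.radius_zero_left]; exact hsn
  · refine higherOrder_radius_eq_of_spatialNorm_eq_of_apply_three_eq a hsn ?_
    show ((Λ₁ : E4 ≃L[ℝ] E4).symm (x - c)) 3 = ((Λ₂ : E4 ≃L[ℝ] E4).symm (x - c)) 3
    rw [a3, b3, h3]

/-- **Moving the centre along the painted `4`-velocity does not change the painted radius.**
[folklore] -/
theorem higherOrder_radius_poincareInv_centre_add_smul (Λ : lorentzGroup) (a : ℝ) (c x : E4) (σ : ℝ) :
    Kerr.radius a (poincareInv Λ (c + σ • (Λ : E4 ≃L[ℝ] E4) (E4.basisVector 0)) x) =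
      Kerr.radius a (poincareInv Λ c x) := by
  refine Kerr.radius_eq_of_spatial_eq a ?_
  rw [poincareInv_centre_add_smul, map_sub, map_smul]
  have h0 : E4.spatial (E4.basisVector 0) = 0 := by
    ext i; simp [E4.spatial_apply, Fin.succ_ne_zero]
  rw [h0, smul_zero, sub_zero]

/-- **Registered one-line carrier form** (`higherOrder_radiusColumns_EF`) of
`higherOrder_radius_poincareInv_eq_of_columns`. [folklore] -/
theorem higherOrder_radiusColumns_EF : open Literature.Geometry.Lorentzian in ∀ {Λ₁ Λ₂ : lorentzGroup} {a : ℝ}, (Λ₁ : E4 ≃L[ℝ] E4) (E4.basisVector 0) = (Λ₂ : E4 ≃L[ℝ] E4) (E4.basisVector 0) → (a = 0 ∨ (Λ₁ : E4 ≃L[ℝ] E4) (E4.basisVector 3) = (Λ₂ : E4 ≃L[ℝ] E4) (E4.basisVector 3)) → ∀ (c x : E4), Kerr.radius a (poincareInv Λ₁ c x) = Kerr.radius a (poincareInv Λ₂ c x) :=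
  fun h0 h3 c x ↦ higherOrder_radius_poincareInv_eq_of_columns h0 h3 c x

end Summit.FinalStateConjecture.FinalStateConjecture.Theorems.SublinearIsFree.Slaving

end
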